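import Literature.Topology.FourManifolds.SmoothOrientationProofs
import Literature.Geometry.Manifold.CoveringSpaceOrientation
import Literature.Topology.CoveringSpaces.FiniteCoveringProper
import Mathlib.Topology.SeparatedMap
import HarnessLib

/-!
# The smooth orientation double cover (Lee 2012, Prop. 15.40, Thm. 15.41)

J. M. Lee, *Introduction to Smooth Manifolds*, 2nd ed. (2012), Ch. 15, "The Orientation
Covering", pp. 392–396. For a `C¹` manifold `M` modelled on `I : ModelWithCorners ℝ E H` the
tree already has the orientation double cover as a *fiber bundle core* with fiber `ℤˣ = {±1}`,
`Literature.Topology.FourManifolds.orientationCoverCore I M` (`SmoothOrientationProofs.lean`: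
trivialised over the chart domains, coordinate changes the signs of the Jacobians of the chart
changes). This file gives its total space the structure the positive-mass argument on
non-orientable hypersurfaces needs (Lee, Prop. 15.40 (a)–(d) and Thm. 15.41):

* `OrientationDoubleCover I M` — the total space, with points `mk x u` (`u : ℤˣ` the orientation
  of `T_x M` relative to the preferred chart at `x`), projection `proj` and sheet interchange
  `flip`; `isCoveringMap_proj` — **`proj` is a two-sheeted covering map** (Prop. 15.40 (c));
* the **lifted smooth structure** (`instChartedSpace`, `instIsManifold`, Prop. 15.40 (a):
  "`M̂` has a unique smooth structure such that `π̂` is a smooth covering map"), for which `proj`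
  is `C^n` and a local diffeomorphism with bijective differentials (`contMDiff_proj`,
  `isLocalDiffeomorph_proj`, `bijective_mfderiv_proj`), continuous lifts of `C^n` maps are `C^n`
  (`contMDiffAt_of_comp_proj`) and `flip` is `C^n` (`contMDiff_flip`);
* point-set topology of the total space: Hausdorff (`instT2Space`), σ-compact and second
  countable over a σ-compact base (`sigmaCompactSpace`, `secondCountableTopology`), `proj` is
  proper (`isProperMap_proj`);
* `eventually_sign_eq` — the defining property of the topology: near `e₀`, the sign coordinate
  of `e` transported to the chart at `proj e₀` is the sign coordinate of `e₀`.

The orientation of the cover and its connectedness over a non-orientable base (Prop. 15.40 (b),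
(d), Thm. 15.41) are in `SmoothOrientationCoverOrientable.lean`. Everything is proved; no named
facts.

## References

* J. M. Lee, *Introduction to Smooth Manifolds*, 2nd ed., GTM 218, Springer (2012/2013), Ch. 15,
  Prop. 15.40, Thm. 15.41; Prop. 4.40 (smooth structure on covering spaces). [LeeSmoothManifolds2013]
* M. W. Hirsch, *Differential Topology*, GTM 33 (1976), §4.4. [HirschDT1976]
-/

open scoped Manifold ContDiff Topology
open Set Function Filter Module Bundle

noncomputable section

namespace Literature.Topology.FourManifolds

variable {E H : Type*} [NormedAddCommGroup E] [NormedSpace ℝ E] [TopologicalSpace H]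
  (I : ModelWithCorners ℝ E H) (M : Type*) [TopologicalSpace M] [ChartedSpace H M]
  [IsManifold I 1 M]

/-- **The orientation double cover** `M̂` of the `C¹` manifold `M` (Lee 2012, Ch. 15, p. 392): the
total space of the fiber bundle core `orientationCoverCore I M` with fiber `ℤˣ = {±1}` — pairs
(point `x`, orientation of `T_x M` recorded by its sign relative to the preferred chart at `x`).
[cite: LeeSmoothManifolds2013, Prop. 15.40] -/
def OrientationDoubleCover : Type _ :=
  Bundle.TotalSpace ℤˣ (orientationCoverCore I M).Fiber

namespace OrientationDoubleCover

variable {I M}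

/-- The topology of the orientation double cover is that of the fiber bundle core (generated by
the local trivializations over the chart domains; Lee 2012, p. 393). [cite: LeeSmoothManifolds2013, Prop. 15.40] -/
instance instTopologicalSpace : TopologicalSpace (OrientationDoubleCover I M) :=
  inferInstanceAs (TopologicalSpace (Bundle.TotalSpace ℤˣ (orientationCoverCore I M).Fiber))

/-- The point of the double cover over `x` with sign `u` relative to the chart at `x`.
[cite: LeeSmoothManifolds2013, Prop. 15.40] -/
def mk (x : M) (u : ℤˣ) : OrientationDoubleCover I M :=
  (⟨x, u⟩ : Bundle.TotalSpace ℤˣ (orientationCoverCore I M).Fiber)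

/-- The projection `π̂ : M̂ → M`. [cite: LeeSmoothManifolds2013, Prop. 15.40] -/
def proj (e : OrientationDoubleCover I M) : M :=
  Bundle.TotalSpace.proj (e : Bundle.TotalSpace ℤˣ (orientationCoverCore I M).Fiber)

/-- The sign coordinate of a point of the double cover (relative to the chart at its base point).
[cite: LeeSmoothManifolds2013, Prop. 15.40] -/
def sign (e : OrientationDoubleCover I M) : ℤˣ :=
  Bundle.TotalSpace.snd (e : Bundle.TotalSpace ℤˣ (orientationCoverCore I M).Fiber)

/-- The base point of `mk x u` is `x`. [folklore] -/
@[simp] theorem proj_mk (x : M) (u : ℤˣ) : proj (mk x u : OrientationDoubleCover I M) = x := rfl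

/-- The sign of `mk x u` is `u`. [folklore] -/
@[simp] theorem sign_mk (x : M) (u : ℤˣ) : sign (mk x u : OrientationDoubleCover I M) = u := rfl

/-- A point is determined by its base point and its sign. [folklore] -/
@[simp] theorem mk_proj_sign (e : OrientationDoubleCover I M) : mk (proj e) (sign e) = e := rfl

/-- Two points with the same base point and the same sign are equal. [folklore] -/
theorem ext {e e' : OrientationDoubleCover I M} (h₁ : proj e = proj e') (h₂ : sign e = sign e') :
    e = e' := by
  rw [← mk_proj_sign e, ← mk_proj_sign e', h₁, h₂]

/-- Equality of points of the double cover. [folklore] -/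
theorem mk_eq_mk_iff {x y : M} {u v : ℤˣ} :
    (mk x u : OrientationDoubleCover I M) = mk y v ↔ x = y ∧ u = v :=
  ⟨fun h ↦ ⟨congrArg proj h, congrArg sign h⟩, fun ⟨h₁, h₂⟩ ↦ by rw [h₁, h₂]⟩

/-- **The fibre over `x` consists of the two points `mk x 1`, `mk x (-1)`.**
[cite: LeeSmoothManifolds2013, Prop. 15.40] -/
theorem eq_mk_one_or_eq_mk_neg_one (e : OrientationDoubleCover I M) :
    e = mk (proj e) 1 ∨ e = mk (proj e) (-1) := by
  rcases Int.units_eq_one_or (sign e) with h | h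
  · exact Or.inl (ext rfl (by rw [h, sign_mk]))
  · exact Or.inr (ext rfl (by rw [h, sign_mk]))

/-- The two points of a fibre are distinct. [folklore] -/
theorem mk_one_ne_mk_neg_one (x : M) : (mk x 1 : OrientationDoubleCover I M) ≠ mk x (-1) := fun h ↦
  neg_one_ne_one_units (congrArg sign h).symm

/-- The fibre of `proj` over `x` is `{mk x 1, mk x (-1)}`. [cite: LeeSmoothManifolds2013, Prop. 15.40] -/
theorem preimage_proj_singleton (x : M) :
    proj ⁻¹' ({x} : Set M) = {(mk x 1 : OrientationDoubleCover I M), mk x (-1)} := by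
  ext e
  simp only [mem_preimage, mem_singleton_iff, mem_insert_iff]
  constructor
  · rintro rfl
    exact eq_mk_one_or_eq_mk_neg_one e
  · rintro (rfl | rfl) <;> rfl

/-- The fibres of `proj` are finite (two points). [cite: LeeSmoothManifolds2013, Prop. 15.40] -/
theorem finite_preimage_proj_singleton (x : M) :
    (proj ⁻¹' ({x} : Set M) : Set (OrientationDoubleCover I M)).Finite := by
  rw [preimage_proj_singleton]
  exact (finite_singleton _).insert _

/-! ### The covering map -/

/-- **`proj : M̂ → M` is a covering map** (Lee 2012, Prop. 15.40 (c); a fiber bundle with discrete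
fiber `ℤˣ`). [cite: LeeSmoothManifolds2013, Prop. 15.40 (c)] -/
theorem isCoveringMap_proj : IsCoveringMap (proj : OrientationDoubleCover I M → M) :=
  FiberBundle.isCoveringMap (F := ℤˣ) (E := (orientationCoverCore I M).Fiber)

/-- The projection is continuous. [cite: LeeSmoothManifolds2013, Prop. 15.40 (c)] -/
theorem continuous_proj : Continuous (proj : OrientationDoubleCover I M → M) :=
  isCoveringMap_proj.continuous

/-- The projection is a local homeomorphism. [cite: LeeSmoothManifolds2013, Prop. 15.40 (c)] -/
theorem isLocalHomeomorph_proj : IsLocalHomeomorph (proj : OrientationDoubleCover I M → M) :=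
  isCoveringMap_proj.isLocalHomeomorph

/-- The projection is onto. [cite: LeeSmoothManifolds2013, Prop. 15.40 (c)] -/
theorem surjective_proj : Surjective (proj : OrientationDoubleCover I M → M) := fun x ↦
  ⟨mk x 1, rfl⟩

/-- `proj` is a proper map (a covering map with finite fibres). [folklore] -/
theorem isProperMap_proj : IsProperMap (proj : OrientationDoubleCover I M → M) :=
  Literature.Topology.CoveringSpaces.IsCoveringMap.isProperMap_of_finite isCoveringMap_proj
    finite_preimage_proj_singleton

/-! ### The sign coordinate in a local trivialization -/

/-- The local trivialization of the core indexed by `x₀` reads a point `e` over the chart domain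
of `x₀` as `(proj e, detSign (Jacobian of the chart change proj e → x₀) * sign e)`.
[cite: LeeSmoothManifolds2013, Prop. 15.40] -/
theorem localTriv_apply_snd (x₀ : M) (e : OrientationDoubleCover I M) :
    ((orientationCoverCore I M).localTriv x₀
        (e : Bundle.TotalSpace ℤˣ (orientationCoverCore I M).Fiber)).2 =
      detSign (tangentCoordChange I (proj e) x₀ (proj e)) * sign e := rfl

/-- **Local constancy of the transported sign** (the defining property of the topology of `M̂`,
Lee 2012, p. 393): near `e₀`, the sign of `e` transported to the chart at `proj e₀` equals the
sign of `e₀`. [cite: LeeSmoothManifolds2013, Prop. 15.40] -/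
theorem eventually_sign_eq (e₀ : OrientationDoubleCover I M) :
    ∀ᶠ e in 𝓝 e₀,
      detSign (tangentCoordChange I (proj e) (proj e₀) (proj e)) * sign e = sign e₀ := by
  set Z : FiberBundleCore M M ℤˣ := orientationCoverCore I M with hZ
  set x₀ := proj e₀ with hx₀
  have hsrc : (Z.localTriv x₀).source ∈
      𝓝 (e₀ : Bundle.TotalSpace ℤˣ Z.Fiber) := by
    apply (Z.localTriv x₀).open_source.mem_nhds
    rw [FiberBundleCore.mem_localTriv_source, ← FiberBundleCore.baseSet_at]
    exact mem_chart_source H x₀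
  have h1 : ContinuousAt (fun e : OrientationDoubleCover I M ↦
      (Z.localTriv x₀ (e : Bundle.TotalSpace ℤˣ Z.Fiber)).2) e₀ :=
    continuousAt_snd.comp ((Z.localTriv x₀).continuousOn.continuousAt hsrc)
  have h2 := h1.preimage_mem_nhds ((isOpen_discrete _).mem_nhds (mem_singleton _))
  filter_upwards [h2] with e he
  rw [mem_preimage, mem_singleton_iff, localTriv_apply_snd, localTriv_apply_snd] at he
  rw [he, tangentCoordChange_self_eq (mem_extChartAt_source x₀), detSign_id, one_mul]

/-! ### The sheet interchange -/

/-- **The sheet interchange** `flip (x, u) = (x, -u)`, the non-trivial deck transformation of the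
double cover. [cite: LeeSmoothManifolds2013, Prop. 15.40] -/
def flip (e : OrientationDoubleCover I M) : OrientationDoubleCover I M := mk (proj e) (-sign e)

/-- The sheet interchange covers the identity. [folklore] -/
@[simp] theorem proj_flip (e : OrientationDoubleCover I M) : proj (flip e) = proj e := rfl

/-- The sheet interchange negates the sign. [folklore] -/
@[simp] theorem sign_flip (e : OrientationDoubleCover I M) : sign (flip e) = -sign e := rfl

/-- The sheet interchange on a point `mk x u`. [folklore] -/
@[simp] theorem flip_mk (x : M) (u : ℤˣ) : flip (mk x u : OrientationDoubleCover I M) = mk x (-u) := rfl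

/-- The sheet interchange is an involution. [folklore] -/
@[simp] theorem flip_flip (e : OrientationDoubleCover I M) : flip (flip e) = e :=
  ext rfl (by rw [sign_flip, sign_flip, neg_neg])

/-- The sheet interchange has no fixed point. [folklore] -/
theorem flip_ne_self (e : OrientationDoubleCover I M) : flip e ≠ e := fun h ↦ by
  have h' := congrArg sign h
  rw [sign_flip] at h'
  rcases Int.units_eq_one_or (sign e) with h1 | h1 <;> rw [h1] at h' <;>
    exact absurd h' (by decide)

/-- The other point of the fibre is the flip. [cite: LeeSmoothManifolds2013, Prop. 15.40] -/
theorem eq_or_eq_flip_of_proj_eq {e e' : OrientationDoubleCover I M} (h : proj e' = proj e) :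
    e' = e ∨ e' = flip e := by
  rcases Int.units_eq_one_or (sign e) with h1 | h1 <;>
    rcases Int.units_eq_one_or (sign e') with h2 | h2
  · exact Or.inl (ext h (h2.trans h1.symm))
  · exact Or.inr (ext h (by rw [sign_flip, h1, h2]))
  · exact Or.inr (ext h (by rw [sign_flip, h1, h2]; rfl))
  · exact Or.inl (ext h (h2.trans h1.symm))

/-- **The sheet interchange is continuous**: in the trivialization at `proj e₀` its sign
coordinate is the negative of that of the identity. [cite: LeeSmoothManifolds2013, Prop. 15.40] -/
theorem continuous_flip : Continuous (flip : OrientationDoubleCover I M → OrientationDoubleCover I M) := by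
  set Z : FiberBundleCore M M ℤˣ := orientationCoverCore I M with hZ
  rw [continuous_iff_continuousAt]
  intro e₀
  have key := (FiberBundle.continuousAt_totalSpace (F := ℤˣ) (E := Z.Fiber)
    (fun e : OrientationDoubleCover I M ↦ (flip e : Bundle.TotalSpace ℤˣ Z.Fiber))
    (x₀ := e₀)).2
  refine key ⟨continuous_proj.continuousAt, ?_⟩
  set x₀ := proj e₀ with hx₀
  have hsrc : (Z.localTriv x₀).source ∈ 𝓝 (e₀ : Bundle.TotalSpace ℤˣ Z.Fiber) := by
    apply (Z.localTriv x₀).open_source.mem_nhds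
    rw [FiberBundleCore.mem_localTriv_source, ← FiberBundleCore.baseSet_at]
    exact mem_chart_source H x₀
  have h1 : ContinuousAt (fun e : OrientationDoubleCover I M ↦
      (Z.localTriv x₀ (e : Bundle.TotalSpace ℤˣ Z.Fiber)).2) e₀ :=
    continuousAt_snd.comp ((Z.localTriv x₀).continuousOn.continuousAt hsrc)
  have h2 : (fun e : OrientationDoubleCover I M ↦
      ((trivializationAt ℤˣ Z.Fiber (proj (flip e₀)))
        (flip e : Bundle.TotalSpace ℤˣ Z.Fiber)).2) =
      fun e ↦ -(Z.localTriv x₀ (e : Bundle.TotalSpace ℤˣ Z.Fiber)).2 := by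
    funext e
    show (Z.localTriv x₀ (flip e : Bundle.TotalSpace ℤˣ Z.Fiber)).2 = _
    rw [localTriv_apply_snd, localTriv_apply_snd, proj_flip, sign_flip, mul_neg]
  exact h1.neg.congr (Eventually.of_forall fun e ↦ (congrFun h2 e).symm)

/-! ### Hausdorff, σ-compact -/

/-- **The orientation double cover of a Hausdorff manifold is Hausdorff**: points in one fibre
are separated by the sheets (a covering map is a separated map), points in different fibres by
`M`. [cite: LeeSmoothManifolds2013, Prop. 15.40] -/
instance instT2Space [T2Space M] : T2Space (OrientationDoubleCover I M) := by
  refine ⟨fun e e' hne ↦ ?_⟩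
  by_cases h : proj e = proj e'
  · exact isCoveringMap_proj.isSeparatedMap e e' h hne
  · obtain ⟨u, v, hu, hv, heu, hev, huv⟩ := t2_separation h
    exact ⟨proj ⁻¹' u, proj ⁻¹' v, hu.preimage continuous_proj, hv.preimage continuous_proj, heu,
      hev, huv.preimage proj⟩

/-- The orientation double cover of a σ-compact manifold is σ-compact (`proj` is proper).
[folklore] -/
theorem sigmaCompactSpace [SigmaCompactSpace M] : SigmaCompactSpace (OrientationDoubleCover I M) := by
  refine ⟨⟨fun n ↦ proj ⁻¹' compactCovering M n,
    fun n ↦ isProperMap_proj.isCompact_preimage (isCompact_compactCovering M n), ?_⟩⟩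
  rw [← preimage_iUnion, iUnion_compactCovering, preimage_univ]

/-! ### The lifted smooth structure -/

/-- **The lifted atlas on the orientation double cover**: the chart at `e` is the sheet of `proj`
through `e` followed by the chart of `M` at `proj e` (Lee 2012, Prop. 15.40 (a) via Prop. 4.40).
[cite: LeeSmoothManifolds2013, Prop. 15.40 (a)] -/
instance instChartedSpace : ChartedSpace H (OrientationDoubleCover I M) :=
  Literature.Geometry.Manifold.liftChartedSpace isLocalHomeomorph_proj

/-- The charts of the double cover are the lifted charts (by definition). [folklore] -/
theorem chartAt_eq (e : OrientationDoubleCover I M) :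
    chartAt H e = (Literature.Geometry.Manifold.coveringPiece isLocalHomeomorph_proj e).trans
      (chartAt H (proj e)) := rfl

/-- The atlas of the double cover is the lifted atlas (by definition). [folklore] -/
theorem atlas_eq : atlas H (OrientationDoubleCover I M) = Set.range fun e : OrientationDoubleCover I M ↦
    (Literature.Geometry.Manifold.coveringPiece isLocalHomeomorph_proj e).trans (chartAt H (proj e)) :=
  rfl

/-- **The orientation double cover of a `C^n` manifold is a `C^n` manifold** (Lee 2012,
Prop. 15.40 (a)). [cite: LeeSmoothManifolds2013, Prop. 15.40 (a)] -/
instance instIsManifold (n : ℕ∞ω) [IsManifold I n M] : IsManifold I n (OrientationDoubleCover I M) :=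
  Literature.Geometry.Manifold.isManifold_of_atlas_eq_lift I n isLocalHomeomorph_proj atlas_eq

/-- Over a σ-compact manifold with second countable model the double cover is second countable.
[folklore] -/
theorem secondCountableTopology [SecondCountableTopology H] [SigmaCompactSpace M] :
    SecondCountableTopology (OrientationDoubleCover I M) :=
  haveI := sigmaCompactSpace (I := I) (M := M)
  ChartedSpace.secondCountable_of_sigmaCompact H (OrientationDoubleCover I M)

variable {n : ℕ∞ω} [IsManifold I n M]

/-- **The covering projection of the orientation double cover is `C^n`** (Lee 2012,
Prop. 15.40 (a): "`π̂` is a smooth covering map"). [cite: LeeSmoothManifolds2013, Prop. 15.40 (a)] -/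
theorem contMDiff_proj : ContMDiff I I n (proj : OrientationDoubleCover I M → M) :=
  Literature.Geometry.Manifold.contMDiff_proj_of_chartAt_eq isLocalHomeomorph_proj chartAt_eq

/-- A continuous map into the double cover is `C^n` where its projection is (lifts of `C^n` maps
are `C^n`). [cite: LeeSmoothManifolds2013, Prop. 4.40 and Prop. 4.33] -/
theorem contMDiffAt_of_comp_proj
    {E' : Type*} [NormedAddCommGroup E'] [NormedSpace ℝ E'] {H' : Type*} [TopologicalSpace H']
    {J : ModelWithCorners ℝ E' H'} {Y : Type*} [TopologicalSpace Y] [ChartedSpace H' Y]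
    {φ : Y → OrientationDoubleCover I M} {y : Y} (hφ : ContinuousAt φ y)
    (h : ContMDiffAt J I n (proj ∘ φ) y) : ContMDiffAt J I n φ y :=
  Literature.Geometry.Manifold.contMDiffAt_of_comp_proj isLocalHomeomorph_proj chartAt_eq hφ h

/-- **The sheet interchange is `C^n`** (a continuous deck transformation).
[cite: LeeSmoothManifolds2013, Prop. 4.40 and Prop. 4.33] -/
theorem contMDiff_flip : ContMDiff I I n (flip : OrientationDoubleCover I M → OrientationDoubleCover I M) :=
  Literature.Geometry.Manifold.contMDiff_of_comp_proj_eq isLocalHomeomorph_proj chartAt_eq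
    continuous_flip (funext proj_flip)

/-- **The projection of the double cover is a local `C^n` diffeomorphism.**
[cite: LeeSmoothManifolds2013, Prop. 4.33 (a)] -/
theorem isLocalDiffeomorph_proj : IsLocalDiffeomorph I I n (proj : OrientationDoubleCover I M → M) :=
  Literature.Geometry.Manifold.isLocalDiffeomorph_proj_of_chartAt_eq isLocalHomeomorph_proj chartAt_eq

/-- The differentials of the projection of the double cover are bijective (`n ≠ 0`); in
particular injective, as needed to pull back Riemannian metrics along `proj`.
[cite: LeeSmoothManifolds2013, Prop. 4.33 (a)] -/
theorem bijective_mfderiv_proj (hn : n ≠ 0) (e : OrientationDoubleCover I M) :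
    Bijective (mfderiv I I (proj : OrientationDoubleCover I M → M) e) :=
  Literature.Geometry.Manifold.bijective_mfderiv_proj_of_chartAt_eq isLocalHomeomorph_proj chartAt_eq
    hn e

end OrientationDoubleCover

end Literature.Topology.FourManifolds

end
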